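import Summits.Ventures.CertifiedManyBodySolver.Observables.PhaseSeparationExclusionTPrimeStripHighUD
import HarnessLib
import HarnessLib.Audit

/-!
# Ventures/CertifiedManyBodySolver — Observables/PhaseSeparationExclusionTPrimeStripHighUE.lean (COMPETING-ORDER words at LARGE `U` by JOINT CONCAVITY — file E: `(≤ 2/5 | ≥ 1)` on `t′ ∈ [s₁, 0] × U ∈ [8, 10.6–12.6]`)

HONEST FRAMING: first certified bounds; not a superconductivity verdict. CLASS = DERIVED / CONTEXT: instantiation of PROVED tree laws
(`Observables/PhaseSeparationExclusionBox` column forms; `HubbardNNNHoppingEnergyDensityRegionBounds.energyDensityTT'_ge_convexComb` = JOINT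
concavity of `e` in `(t′, U)`) on CLAIM NODES BY NAME — the same nodes as the strip words of record: the VARBOX planes
`cert_obx32x4tpm1o4D1200_openbox_32x4_N112_planes` (filling 7/8, #445’s witness) / `cert_r450_openbox_32x4_N96_planes` (filling 3/4), the `U = 8`
K2DIAG-A bootstrap `cert_laBoxE_K2diag_GU8n1tpm3o10_j299783_up` with #472 · #428 (`lsco_n1_law8_of`, hubbard-obs-p2 / hubbard-downfold-unc-2), and the
`t′ = 0` Mott-column floors #489 (U = 12) / #502 (U = 16) (`cert_r489_…`, `cert_r502_…`, hanK7R6); dilute floors = `t′`-chords of PREMISE-FREE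
kernel Fermi-sea tangent rows. Nothing is asserted beyond that; no new certificate, no CERTIFIED row, no cell word of the meter’s kind, no MOVE.
Seat hubbard-box-p3 g27 (`prover-hubbard-box-p3-g27-0`, S2 row «joint concavity … t′-boxes from the t′ ∈ {0, −1/4} anchors»); generator
`pub/hubbard-fast/hubbard-box-p3/work-g27/highU/emit_highU.py` (exact `fractions`; decimals = 10-place DOWNWARD roundings; data `highU_data.json`).
Device and triangle column laws: files A and D (`PhaseSeparationExclusionTPrimeStripHighU`, §0–§1).

WHAT IT SAYS (`t = 1`, thermodynamic limit; conditional BY NAME on the nodes above): `(2/5∣1)` cell C `[-3 / 20, 0] × [8, 121 / 10]` (columns 8 ∣ 12: 0.0404968 ∣ 0.0033344 at `s = -3 / 20`; far end `U = 121 / 10`: 0.0005175); `(2/5∣1)` cell D `[-1 / 4, 0] × [8, 19 / 2]` (columns 8 ∣ 9: 0.0237622 ∣ 0.0162890 at `s = -1 / 4`; far end `U = 19 / 2`: 0.0022040) — for every `(t′, U)` of each cell no macroscopic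
mixture of translation-invariant states with densities `0 < ρ₁ ≤ n₁` and `1 ≤ ρ₂ < 2` is a ground state, at ANY filling in between.
WHAT THIS IS NOT: a certificate; a CERTIFIED row; a statement at `t′ < s₁` for `U > 9.65`, at `t′ > 0`, `T > 0`, or about superconductivity.
[cite: Israel1979, Thm. I.2.4] [cite: EmeryKivelsonLin1990, pp. 475–476] [cite: Ruelle1969, §3.3] [cite: Israel1979, Thm. I.3.4] [cite: Ruelle1969, §3.3] [cite: LiebLoss1993, §8, Theorem 8.2]
-/


noncomputable section

namespace Summit.Ventures.CertifiedManyBodySolver.Observables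

open Summit.Ventures.CertifiedManyBodySolver.Certificates Summit.Ventures.CertifiedManyBodySolver.Downfold
open Literature.MathematicalPhysics.QuantumLattice Literature.MathematicalPhysics.QuantumLattice.ThermodynamicLimit
open Literature.MathematicalPhysics.QuantumLattice.InfVolFermionState Set

/-! ## §0 The dilute floor on `[−1/4, 0]` touching `2/5` -/

/-- **Dilute floor on `t′ ∈ [−1/4, 0]` at density `n₁`, rows touching `2/5`** (any `0 ≤ n₁ < 2`, every `U ≥ 0`): the `t′`-chord of the kernel tangent rows
`fermiSeaTangentRow_tPrime_neg_one_div_four_at_two_div_five` and `fermiSeaTangentRow_tPrime_zero_at_two_div_five` (premise-free). [cite: LiebLoss1993, §8, Theorem 8.2] [cite: Ruelle1969, §3.3] -/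
theorem highU_dilute2o5_floor_q {n₁ : ℝ} (hn0 : 0 ≤ n₁) (hn2 : n₁ < 2) :
    ∀ s ∈ Icc (-1 / 4 : ℝ) 0, ∀ U : ℝ, 0 ≤ U →
      ((0 - s) * ((-0.2414810972 : ℝ) + (-3661 / 2048) * n₁) + (s - (-1 / 4)) * ((-0.4048981559 : ℝ) + (-3813 / 2048) * n₁)) / (0 - (-1 / 4)) ≤
        energyDensityTT' 1 s U n₁ :=
  floor_on_cell_of_tPrime_end_rows 1 hn0 hn2 (by norm_num)
    (fun _ hU => fermiSeaTangentRow_tPrime_neg_one_div_four_at_two_div_five hU hn0 hn2)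
    (fun _ hU => fermiSeaTangentRow_tPrime_zero_at_two_div_five hU hn0 hn2)

/-! ## §1 `(≤ 2/5 | ≥ 1)` cells C `[−3/20, 0] × [8, 121/10]` and D `[−1/4, 0] × [8, 19/2]` -/

/-- **`(≤ 2/5 | ≥ 1)` — cell C columns: `t′ ∈ [-3 / 20, 0]`, `U ∈ [8, 12]`** (mean density `3 / 4`, weights `5 / 12, 7 / 12`; cap = the filling-3/4 VARBOX plane r450 (t′-slope kept);
`n = 1` columns: the `U = 8` K2DIAG law and the TRIANGLE law `tri_n1_law12h_of` at `U = 12`; dilute floor `strip25_dilute_floor_right`; exact column margins (10-dp down) at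
`(s = -3 / 20 | 0)`: `U = 8`: 0.0404968656 | 0.0652309237; `U = 12`: 0.0033344851 | 0.0280685432). [cite: Israel1979, Thm. I.2.4] [cite: EmeryKivelsonLin1990, pp. 475–476] [cite: Ruelle1969, §3.3] -/
theorem highU_2o5_C_columns (h450 : cert_r450_openbox_32x4_N96_planes)
    (hK8 : cert_laBoxE_K2diag_GU8n1tpm3o10_j299783_up) (h472 : cert_r472_pb2_tl_upper_n1_U8) (h428 : cert_r428_hubSQ_hanK7R6_U8_r5_e4_so4blk)
    (h502 : cert_r502_hubSQ_hanK7R6_U16_r5_e4_so4blk)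
    {s : ℝ} (hs : s ∈ Icc (-3 / 20 : ℝ) 0) {U : ℝ} (hU : U ∈ Icc (8 : ℝ) (12 : ℝ))
    {ω₁ ω₂ : InfVolFermionState 2} (h₁ : ω₁.IsTranslationInvariant) (h₂ : ω₂.IsTranslationInvariant)
    (hρ₁ : 0 < ω₁.density) (hρ₁' : ω₁.density ≤ 2 / 5) (hρ₂ : 1 ≤ ω₂.density) (hρ₂' : ω₂.density < 2)
    {lam : ℝ} (hl0 : 0 < lam) (hl1 : lam < 1) :
    energyDensityTT' 1 s U (mix lam hl0.le hl1.le ω₁ ω₂).density <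
      (mix lam hl0.le hl1.le ω₁ ω₂).meanEnergy (hubbardTTPrimeFermionInteraction 1 s U) 1 := by
  refine ps_not_groundState_mix_on_cell_of_columns_tcap 1 (s₁ := -3 / 20) (s₂ := 0) (U₁ := 8) (U₂ := 12)
    (n₁ := 2 / 5) (n₂ := 1) (a := 5 / 12) (b := 7 / 12) (by norm_num) (by norm_num) (by norm_num) (by norm_num)
    (by norm_num) (by norm_num) (by norm_num) (by norm_num)
    (r450_capPlane_tcap_on_cell_of h450 (by norm_num) (by norm_num) (by norm_num))
    (fun s hs => lsco_n1_law8_of hK8 h472 h428 s ⟨hs.1.trans' (by norm_num), hs.2⟩)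
    (fun s hs => tri_n1_law12h_of hK8 h472 h428 h502 s ⟨hs.1.trans' (by norm_num), hs.2⟩)
    (fun s hs U hU => strip25_dilute_floor_right (n₁ := 2 / 5) (by norm_num) (by norm_num) s ⟨hs.1.trans' (by norm_num), hs.2⟩ U (by linarith [hU.1]))
    ?_ ?_ hs hU h₁ h₂ hρ₁ hρ₁' hρ₂ hρ₂' hl0 hl1
  · intro s hs; obtain ⟨h1, h2⟩ := hs; push_cast; norm_num; nlinarith [h1, h2]
  · intro s hs; obtain ⟨h1, h2⟩ := hs; push_cast; norm_num; nlinarith [h1, h2]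

/-- **`(≤ 2/5 | ≥ 1)` — cell C above the column: `t′ ∈ [-3 / 20, 0]`, `U ∈ [12, 121 / 10]`** (the triangle law at `U = 12` floors every larger `U`
by `U`-monotonicity [folklore: `energyDensityTT'_mono_U`]; the cap grows by `c₁` per unit `U`; far-end margins `0.0005175035` | `0.0252515616`). [cite: Israel1979, Thm. I.2.4] -/
theorem highU_2o5_C_above (h450 : cert_r450_openbox_32x4_N96_planes)
    (hK8 : cert_laBoxE_K2diag_GU8n1tpm3o10_j299783_up) (h472 : cert_r472_pb2_tl_upper_n1_U8) (h428 : cert_r428_hubSQ_hanK7R6_U8_r5_e4_so4blk)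
    (h502 : cert_r502_hubSQ_hanK7R6_U16_r5_e4_so4blk)
    {s : ℝ} (hs : s ∈ Icc (-3 / 20 : ℝ) 0) {U : ℝ} (hU : U ∈ Icc (12 : ℝ) (121 / 10 : ℝ))
    {ω₁ ω₂ : InfVolFermionState 2} (h₁ : ω₁.IsTranslationInvariant) (h₂ : ω₂.IsTranslationInvariant)
    (hρ₁ : 0 < ω₁.density) (hρ₁' : ω₁.density ≤ 2 / 5) (hρ₂ : 1 ≤ ω₂.density) (hρ₂' : ω₂.density < 2)
    {lam : ℝ} (hl0 : 0 < lam) (hl1 : lam < 1) :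
    energyDensityTT' 1 s U (mix lam hl0.le hl1.le ω₁ ω₂).density <
      (mix lam hl0.le hl1.le ω₁ ω₂).meanEnergy (hubbardTTPrimeFermionInteraction 1 s U) 1 := by
  refine ps_not_groundState_mix_above_column_tcap 1 (s₁ := -3 / 20) (s₂ := 0) (U₂ := 12) (U₃ := 121 / 10)
    (n₁ := 2 / 5) (n₂ := 1) (a := 5 / 12) (b := 7 / 12) (by norm_num) (by norm_num) (by norm_num) (by norm_num)
    (by norm_num) (by norm_num) (by norm_num) (by norm_num)
    (r450_capPlane_tcap_on_cell_of h450 (by norm_num) (by norm_num) (by norm_num))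
    (fun s hs => tri_n1_law12h_of hK8 h472 h428 h502 s ⟨hs.1.trans' (by norm_num), hs.2⟩)
    (fun s hs U hU => strip25_dilute_floor_right (n₁ := 2 / 5) (by norm_num) (by norm_num) s ⟨hs.1.trans' (by norm_num), hs.2⟩ U (by linarith [hU.1]))
    ?_ hs hU h₁ h₂ hρ₁ hρ₁' hρ₂ hρ₂' hl0 hl1
  intro s hs; obtain ⟨h1, h2⟩ := hs; push_cast; norm_num; nlinarith [h1, h2]

/-- **THE `(≤ 2/5 | ≥ 1)` SENTENCE ON `t′ ∈ [-3 / 20, 0] × U ∈ [8, 121 / 10]`** (cell C). For every `(s, U)` of the cell no mixture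
`λω₁ + (1−λ)ω₂` (`0 < λ < 1`) of translation-invariant states of the 2D `t–t′` Hubbard model at `(1, s, U)` with densities `0 < ρ(ω₁) ≤ 2/5`
and `1 ≤ ρ(ω₂) < 2` is a ground state — at ANY filling in between. Conditional BY NAME on the r450 plane node, the `U = 8` K2DIAG-A
node with #472 · #428, and the `t′ = 0` Mott-column node(s) #502; dilute floors premise-free. [cite: Israel1979, Thm. I.2.4] [cite: EmeryKivelsonLin1990, pp. 475–476] [cite: Ruelle1969, §3.3] -/
theorem highU_not_groundState_mix_le_2o5_ge_one_C (h450 : cert_r450_openbox_32x4_N96_planes)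
    (hK8 : cert_laBoxE_K2diag_GU8n1tpm3o10_j299783_up) (h472 : cert_r472_pb2_tl_upper_n1_U8) (h428 : cert_r428_hubSQ_hanK7R6_U8_r5_e4_so4blk)
    (h502 : cert_r502_hubSQ_hanK7R6_U16_r5_e4_so4blk)
    {s : ℝ} (hs : s ∈ Icc (-3 / 20 : ℝ) 0) {U : ℝ} (hU : U ∈ Icc (8 : ℝ) (121 / 10 : ℝ))
    {ω₁ ω₂ : InfVolFermionState 2} (h₁ : ω₁.IsTranslationInvariant) (h₂ : ω₂.IsTranslationInvariant)
    (hρ₁ : 0 < ω₁.density) (hρ₁' : ω₁.density ≤ 2 / 5) (hρ₂ : 1 ≤ ω₂.density) (hρ₂' : ω₂.density < 2)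
    {lam : ℝ} (hl0 : 0 < lam) (hl1 : lam < 1) :
    energyDensityTT' 1 s U (mix lam hl0.le hl1.le ω₁ ω₂).density <
      (mix lam hl0.le hl1.le ω₁ ω₂).meanEnergy (hubbardTTPrimeFermionInteraction 1 s U) 1 := by
  rcases le_total U 12 with hUl | hUr
  · exact highU_2o5_C_columns h450 hK8 h472 h428 h502 hs ⟨hU.1, hUl⟩ h₁ h₂ hρ₁ hρ₁' hρ₂ hρ₂' hl0 hl1
  · exact highU_2o5_C_above h450 hK8 h472 h428 h502 hs ⟨hUr, hU.2⟩ h₁ h₂ hρ₁ hρ₁' hρ₂ hρ₂' hl0 hl1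

/-- **`(≤ 2/5 | ≥ 1)` — cell D columns: `t′ ∈ [-1 / 4, 0]`, `U ∈ [8, 9]`** (mean density `3 / 4`, weights `5 / 12, 7 / 12`; cap = the filling-3/4 VARBOX plane r450 (t′-slope kept);
`n = 1` columns: the `U = 8` K2DIAG law and the TRIANGLE law `tri_n1_law9f_of` at `U = 9`; dilute floor `highU_dilute2o5_floor_q`; exact column margins (10-dp down) at
`(s = -1 / 4 | 0)`: `U = 8`: 0.0237622386 | 0.0652309237; `U = 9`: 0.0162890074 | 0.0577576925). [cite: Israel1979, Thm. I.2.4] [cite: EmeryKivelsonLin1990, pp. 475–476] [cite: Ruelle1969, §3.3] -/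
theorem highU_2o5_D_columns (h450 : cert_r450_openbox_32x4_N96_planes)
    (hK8 : cert_laBoxE_K2diag_GU8n1tpm3o10_j299783_up) (h472 : cert_r472_pb2_tl_upper_n1_U8) (h428 : cert_r428_hubSQ_hanK7R6_U8_r5_e4_so4blk)
    (h489 : cert_r489_hubSQ_hanK7R6_U12_r5_e4_so4blk) (h502 : cert_r502_hubSQ_hanK7R6_U16_r5_e4_so4blk)
    {s : ℝ} (hs : s ∈ Icc (-1 / 4 : ℝ) 0) {U : ℝ} (hU : U ∈ Icc (8 : ℝ) (9 : ℝ))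
    {ω₁ ω₂ : InfVolFermionState 2} (h₁ : ω₁.IsTranslationInvariant) (h₂ : ω₂.IsTranslationInvariant)
    (hρ₁ : 0 < ω₁.density) (hρ₁' : ω₁.density ≤ 2 / 5) (hρ₂ : 1 ≤ ω₂.density) (hρ₂' : ω₂.density < 2)
    {lam : ℝ} (hl0 : 0 < lam) (hl1 : lam < 1) :
    energyDensityTT' 1 s U (mix lam hl0.le hl1.le ω₁ ω₂).density <
      (mix lam hl0.le hl1.le ω₁ ω₂).meanEnergy (hubbardTTPrimeFermionInteraction 1 s U) 1 := by
  refine ps_not_groundState_mix_on_cell_of_columns_tcap 1 (s₁ := -1 / 4) (s₂ := 0) (U₁ := 8) (U₂ := 9)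
    (n₁ := 2 / 5) (n₂ := 1) (a := 5 / 12) (b := 7 / 12) (by norm_num) (by norm_num) (by norm_num) (by norm_num)
    (by norm_num) (by norm_num) (by norm_num) (by norm_num)
    (r450_capPlane_tcap_on_cell_of h450 (by norm_num) (by norm_num) (by norm_num))
    (fun s hs => lsco_n1_law8_of hK8 h472 h428 s ⟨hs.1.trans' (by norm_num), hs.2⟩)
    (fun s hs => tri_n1_law9f_of hK8 h472 h428 h489 h502 s ⟨hs.1.trans' (by norm_num), hs.2⟩)
    (fun s hs U hU => highU_dilute2o5_floor_q (n₁ := 2 / 5) (by norm_num) (by norm_num) s ⟨hs.1.trans' (by norm_num), hs.2⟩ U (by linarith [hU.1]))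
    ?_ ?_ hs hU h₁ h₂ hρ₁ hρ₁' hρ₂ hρ₂' hl0 hl1
  · intro s hs; obtain ⟨h1, h2⟩ := hs; push_cast; norm_num; nlinarith [h1, h2]
  · intro s hs; obtain ⟨h1, h2⟩ := hs; push_cast; norm_num; nlinarith [h1, h2]

/-- **`(≤ 2/5 | ≥ 1)` — cell D above the column: `t′ ∈ [-1 / 4, 0]`, `U ∈ [9, 19 / 2]`** (the triangle law at `U = 9` floors every larger `U`
by `U`-monotonicity [folklore: `energyDensityTT'_mono_U`]; the cap grows by `c₁` per unit `U`; far-end margins `0.0022040993` | `0.0436727844`). [cite: Israel1979, Thm. I.2.4] -/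
theorem highU_2o5_D_above (h450 : cert_r450_openbox_32x4_N96_planes)
    (hK8 : cert_laBoxE_K2diag_GU8n1tpm3o10_j299783_up) (h472 : cert_r472_pb2_tl_upper_n1_U8) (h428 : cert_r428_hubSQ_hanK7R6_U8_r5_e4_so4blk)
    (h489 : cert_r489_hubSQ_hanK7R6_U12_r5_e4_so4blk) (h502 : cert_r502_hubSQ_hanK7R6_U16_r5_e4_so4blk)
    {s : ℝ} (hs : s ∈ Icc (-1 / 4 : ℝ) 0) {U : ℝ} (hU : U ∈ Icc (9 : ℝ) (19 / 2 : ℝ))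
    {ω₁ ω₂ : InfVolFermionState 2} (h₁ : ω₁.IsTranslationInvariant) (h₂ : ω₂.IsTranslationInvariant)
    (hρ₁ : 0 < ω₁.density) (hρ₁' : ω₁.density ≤ 2 / 5) (hρ₂ : 1 ≤ ω₂.density) (hρ₂' : ω₂.density < 2)
    {lam : ℝ} (hl0 : 0 < lam) (hl1 : lam < 1) :
    energyDensityTT' 1 s U (mix lam hl0.le hl1.le ω₁ ω₂).density <
      (mix lam hl0.le hl1.le ω₁ ω₂).meanEnergy (hubbardTTPrimeFermionInteraction 1 s U) 1 := by
  refine ps_not_groundState_mix_above_column_tcap 1 (s₁ := -1 / 4) (s₂ := 0) (U₂ := 9) (U₃ := 19 / 2)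
    (n₁ := 2 / 5) (n₂ := 1) (a := 5 / 12) (b := 7 / 12) (by norm_num) (by norm_num) (by norm_num) (by norm_num)
    (by norm_num) (by norm_num) (by norm_num) (by norm_num)
    (r450_capPlane_tcap_on_cell_of h450 (by norm_num) (by norm_num) (by norm_num))
    (fun s hs => tri_n1_law9f_of hK8 h472 h428 h489 h502 s ⟨hs.1.trans' (by norm_num), hs.2⟩)
    (fun s hs U hU => highU_dilute2o5_floor_q (n₁ := 2 / 5) (by norm_num) (by norm_num) s ⟨hs.1.trans' (by norm_num), hs.2⟩ U (by linarith [hU.1]))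
    ?_ hs hU h₁ h₂ hρ₁ hρ₁' hρ₂ hρ₂' hl0 hl1
  intro s hs; obtain ⟨h1, h2⟩ := hs; push_cast; norm_num; nlinarith [h1, h2]

/-- **THE `(≤ 2/5 | ≥ 1)` SENTENCE ON `t′ ∈ [-1 / 4, 0] × U ∈ [8, 19 / 2]`** (cell D). For every `(s, U)` of the cell no mixture
`λω₁ + (1−λ)ω₂` (`0 < λ < 1`) of translation-invariant states of the 2D `t–t′` Hubbard model at `(1, s, U)` with densities `0 < ρ(ω₁) ≤ 2/5`
and `1 ≤ ρ(ω₂) < 2` is a ground state — at ANY filling in between. Conditional BY NAME on the r450 plane node, the `U = 8` K2DIAG-A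
node with #472 · #428, and the `t′ = 0` Mott-column node(s) #489 · #502; dilute floors premise-free. [cite: Israel1979, Thm. I.2.4] [cite: EmeryKivelsonLin1990, pp. 475–476] [cite: Ruelle1969, §3.3] -/
theorem highU_not_groundState_mix_le_2o5_ge_one_D (h450 : cert_r450_openbox_32x4_N96_planes)
    (hK8 : cert_laBoxE_K2diag_GU8n1tpm3o10_j299783_up) (h472 : cert_r472_pb2_tl_upper_n1_U8) (h428 : cert_r428_hubSQ_hanK7R6_U8_r5_e4_so4blk)
    (h489 : cert_r489_hubSQ_hanK7R6_U12_r5_e4_so4blk) (h502 : cert_r502_hubSQ_hanK7R6_U16_r5_e4_so4blk)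
    {s : ℝ} (hs : s ∈ Icc (-1 / 4 : ℝ) 0) {U : ℝ} (hU : U ∈ Icc (8 : ℝ) (19 / 2 : ℝ))
    {ω₁ ω₂ : InfVolFermionState 2} (h₁ : ω₁.IsTranslationInvariant) (h₂ : ω₂.IsTranslationInvariant)
    (hρ₁ : 0 < ω₁.density) (hρ₁' : ω₁.density ≤ 2 / 5) (hρ₂ : 1 ≤ ω₂.density) (hρ₂' : ω₂.density < 2)
    {lam : ℝ} (hl0 : 0 < lam) (hl1 : lam < 1) :
    energyDensityTT' 1 s U (mix lam hl0.le hl1.le ω₁ ω₂).density <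
      (mix lam hl0.le hl1.le ω₁ ω₂).meanEnergy (hubbardTTPrimeFermionInteraction 1 s U) 1 := by
  rcases le_total U 9 with hUl | hUr
  · exact highU_2o5_D_columns h450 hK8 h472 h428 h489 h502 hs ⟨hU.1, hUl⟩ h₁ h₂ hρ₁ hρ₁' hρ₂ hρ₂' hl0 hl1
  · exact highU_2o5_D_above h450 hK8 h472 h428 h489 h502 hs ⟨hUr, hU.2⟩ h₁ h₂ hρ₁ hρ₁' hρ₂ hρ₂' hl0 hl1

end Summit.Ventures.CertifiedManyBodySolver.Observables

end
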